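import Mathlib
import Literature.MathematicalPhysics.QuantumLattice.Imbrie2016.UmbilicPlanes

/-!
# The `B_X` chart of the three-spin block: cluster frame, first- and second-order tables

Finite algebraic facts at the isolated umbilic point `b_X` (`t₁ = t₃ = s`, all other parameters
`0`) of the three-spin block, [cite: ImbrieJSP2016, eq. (1.1), assumption LLA(ν, C)]
Repair cell b2b-imbrie, LLA.md blocks P16(a) (the second-order family `𝔤` at `B_X`) and Q8(e)
(local law at `B_X`), refereed in REFEREE.md G228, G279.
J. Z. Imbrie, *On many-body localization for quantum spin chains*,
J. Stat. Phys. 163 (2016) 998–1048, arXiv:1403.7837 (Theorem 1.1, Assumption LLA).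

`H₀ = H(b_X) = s(X₁ + X₃)` has levels `0` (×4) and `±2s` (×2).  The zero level is
`T = span{χ₊, χ₋}₁₃ ⊗ ℂ²₂` with `χ₊ = |+−⟩ₓ`, `χ₋ = |−+⟩ₓ` (as real functions of the z-basis
indices: `χ₊ = σ₃`, `χ₋ = σ₁`, squared norm 4), site 2 being the FREE QUBIT; its complement is
spanned by `g₊ = |++⟩ₓ = 1` (energy `+2s`) and `g₋ = |−−⟩ₓ = σ₁σ₃` (energy `−2s`), times `ℂ²₂`.
FIRST ORDER (`compress_*`): `Z₂ ↦ Z⊗1`, `X₂ ↦ X⊗1`, `X₁ ↦ 1⊗τ_z`, `X₃ ↦ −1⊗τ_z` (so the swept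
directions `h₂, t₂, t₁ − t₃` give `Z⊗1, X⊗1, 1⊗τ_z` and `X₁ + X₃ ↦ 0`), while
`Z₁, Z₃, Z₁Z₂, Z₂Z₃ ↦ 0`: these four directions act only at second order.
SECOND ORDER (`second_order`): for `V = u₁Z₁ + u₃Z₃ + v₁Z₁Z₂ + v₃Z₂Z₃` one has, EXACTLY as kets,
`V H₀ V (e_j ⊗ χ_α) = −2s·τ_z(α)·(A₁² − A₃²)·(e_j ⊗ χ_α)`, `A₁ = u₁ + v₁σ₂(j)`, `A₃ = u₃ + v₃σ₂(j)`;
since `H₀³ = 4s² H₀` (`H0_cube`) the reduced resolvent of `H₀` at `0` is `H₀/(4s²)` on `T^⊥`, so the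
second-order effective operator `−P_T V (H₀|_{T^⊥})⁻¹ V P_T` equals `τ_z ⊗ (A² − B²)/(2s)` with
`A = u₁ + v₁Z₂`, `B = u₃ + v₃Z₂` — formula P16(a) of LLA.md (`μ₁ = (h₁J₁ − h₃J₂)/s`, the
indefinite quadratic form whose zero cone is the trace of `B_X^ext`, Q8(e)).  Kets and operators as in
`UmbilicPlanes`; everything is polynomial algebra.
-/

namespace Literature.MathematicalPhysics.QuantumLattice.Imbrie2016.ChartBX

open UmbilicPlanes (Ket sgn transverse diag)

/-- [cite: ImbrieJSP2016, eq. (1.1)] The pair states on sites 1,3: `χ 0 = |+−⟩ₓ = σ₃`,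
`χ 1 = |−+⟩ₓ = σ₁` (unnormalised, squared norm 4 with the free qubit). -/
def chi (α : Fin 2) (a c : Fin 2) : ℝ := if α = 0 then sgn c else sgn a

/-- [cite: ImbrieJSP2016, eq. (1.1)] The cluster frame `f j α = e_j ⊗ χ_α` (free qubit = site 2). -/
def frame (j α : Fin 2) : Ket := fun a b c => (if b = j then 1 else 0) * chi α a c

/-- [cite: ImbrieJSP2016, eq. (1.1)] The complementary frame `g j γ`: `γ = 0 ↦ |++⟩ₓ = 1`
(energy `+2s`), `γ = 1 ↦ |−−⟩ₓ = σ₁σ₃` (energy `−2s`). -/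
def cframe (j γ : Fin 2) : Ket :=
  fun a b c => (if b = j then 1 else 0) * (if γ = 0 then 1 else sgn a * sgn c)

/-- [cite: ImbrieJSP2016, eq. (1.1)] `H₀ = H(b_X) = s(X₁ + X₃)`. -/
def H0 (s : ℝ) (ψ : Ket) : Ket := transverse s 0 s ψ

/-- [cite: ImbrieJSP2016, eq. (1.1)] The second-order directions `V = u₁Z₁ + u₃Z₃ + v₁Z₁Z₂ + v₃Z₂Z₃`. -/
def V (u₁ u₃ v₁ v₃ : ℝ) (ψ : Ket) : Ket := diag 0 u₁ 0 u₃ v₁ v₃ ψ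

/-- [cite: ImbrieJSP2016, eq. (1.1)] The frames `f`, `g` together are orthogonal, squared norms 4. -/
theorem frame_gram (i j α β : Fin 2) :
    UmbilicPlanes.inner (frame i α) (frame j β) = (if i = j ∧ α = β then 4 else 0) ∧
    UmbilicPlanes.inner (cframe i α) (cframe j β) = (if i = j ∧ α = β then 4 else 0) ∧
    UmbilicPlanes.inner (frame i α) (cframe j β) = 0 := by
  fin_cases i <;> fin_cases j <;> fin_cases α <;> fin_cases β <;>
    norm_num [UmbilicPlanes.inner, frame, cframe, chi, sgn, Fin.sum_univ_two]

/-- [cite: ImbrieJSP2016, eq. (1.1)] `T = ker H₀` on the frame and `H₀ g_± = ±2s g_±`. -/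
theorem H0_frames (s : ℝ) (j α : Fin 2) :
    H0 s (frame j α) = (fun _ _ _ => (0 : ℝ)) ∧
    H0 s (cframe j α) = fun a b c => (2 * s * sgn α) * cframe j α a b c := by
  refine ⟨?_, ?_⟩ <;> funext a b c <;> fin_cases j <;> fin_cases α <;> fin_cases a <;> fin_cases b <;>
    fin_cases c <;> norm_num [H0, transverse, frame, cframe, chi, sgn, Fin.rev] <;> ring

/-- [cite: ImbrieJSP2016, eq. (1.1)] `H₀³ = 4s² H₀`: the minimal polynomial `x(x² − 4s²)`, so the
reduced resolvent of `H₀` at energy `0` on `T^⊥` is `H₀/(4s²)`. -/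
theorem H0_cube (s : ℝ) (ψ : Ket) :
    H0 s (H0 s (H0 s ψ)) = fun a b c => 4 * s ^ 2 * H0 s ψ a b c := by
  funext a b c
  simp only [H0, transverse, Fin.rev_rev]
  ring

/-- [cite: ImbrieJSP2016, eq. (1.1)] FIRST ORDER, free qubit: `Z₂ ↦ Z⊗1`, `X₂ ↦ X⊗1`
(swept directions `h₂`, `t₂`). -/
theorem compress_free (i j α β : Fin 2) :
    UmbilicPlanes.inner (frame i α) (diag 0 0 1 0 0 0 (frame j β))
        = (if i = j ∧ α = β then 4 * sgn i else 0) ∧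
    UmbilicPlanes.inner (frame i α) (transverse 0 1 0 (frame j β))
        = (if i ≠ j ∧ α = β then 4 else 0) := by
  fin_cases i <;> fin_cases j <;> fin_cases α <;> fin_cases β <;>
    norm_num [UmbilicPlanes.inner, diag, UmbilicPlanes.landscape, transverse, frame, chi, sgn,
      Fin.sum_univ_two, Fin.rev]

/-- [cite: ImbrieJSP2016, eq. (1.1)] FIRST ORDER, pair: `X₁ ↦ 1⊗τ_z`, `X₃ ↦ −1⊗τ_z` (so
`t₁ − t₃` sweeps `1⊗τ_z` and `X₁ + X₃ ↦ 0`). -/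
theorem compress_X13 (i j α β : Fin 2) :
    UmbilicPlanes.inner (frame i α) (transverse 1 0 0 (frame j β))
        = (if i = j ∧ α = β then 4 * sgn α else 0) ∧
    UmbilicPlanes.inner (frame i α) (transverse 0 0 1 (frame j β))
        = (if i = j ∧ α = β then -(4 * sgn α) else 0) := by
  fin_cases i <;> fin_cases j <;> fin_cases α <;> fin_cases β <;>
    norm_num [UmbilicPlanes.inner, transverse, frame, chi, sgn, Fin.sum_univ_two, Fin.rev]

/-- [cite: ImbrieJSP2016, eq. (1.1)] FIRST ORDER: `Z₁, Z₃, Z₁Z₂, Z₂Z₃ ↦ 0` on `T` (for all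
coefficients `u₁, u₃, v₁, v₃`): these directions act only at second order. -/
theorem compress_V (u₁ u₃ v₁ v₃ : ℝ) (i j α β : Fin 2) :
    UmbilicPlanes.inner (frame i α) (V u₁ u₃ v₁ v₃ (frame j β)) = 0 := by
  fin_cases i <;> fin_cases j <;> fin_cases α <;> fin_cases β <;>
    norm_num [UmbilicPlanes.inner, V, diag, UmbilicPlanes.landscape, frame, chi, sgn,
      Fin.sum_univ_two] <;> ring

/-- [cite: ImbrieJSP2016, eq. (1.1), assumption LLA(ν, C)] SECOND ORDER (P16(a) of LLA.md):
`V H₀ V (e_j ⊗ χ_α) = −2s·τ_z(α)·(A₁² − A₃²)·(e_j ⊗ χ_α)` exactly, with `A₁ = u₁ + v₁σ₂(j)`,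
`A₃ = u₃ + v₃σ₂(j)`; dividing by `−4s²` (`H0_cube`) gives the effective operator
`τ_z ⊗ (A² − B²)/(2s)`, `A = u₁ + v₁Z₂`, `B = u₃ + v₃Z₂`, whose `Z⊗τ_z`-coefficient is
`μ₁ = (u₁v₁ − u₃v₃)/s`. -/
theorem second_order (u₁ u₃ v₁ v₃ s : ℝ) (j α : Fin 2) :
    V u₁ u₃ v₁ v₃ (H0 s (V u₁ u₃ v₁ v₃ (frame j α)))
      = fun a b c => (-2 * s * sgn α * ((u₁ + v₁ * sgn j) ^ 2 - (u₃ + v₃ * sgn j) ^ 2))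
          * frame j α a b c := by
  funext a b c
  fin_cases j <;> fin_cases α <;> fin_cases a <;> fin_cases b <;> fin_cases c <;>
    norm_num [V, H0, diag, UmbilicPlanes.landscape, transverse, frame, chi, sgn, Fin.rev] <;> ring

end Literature.MathematicalPhysics.QuantumLattice.Imbrie2016.ChartBX
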